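import Literature.NumberTheory.LFunctions.Zhang2022.EllFirstOrderBox
import HarnessLib

/-!
# Zhang (2022), B-ell first-order reading on the three `K₀` vectors: the parameter-free part of test #1 in
# closed form, and model-consistency / first-order emptiness GIVEN the dipole coefficient's size
# (cell `landau-siegel`, family B-ell; KILL-draft §1 `K₀` clause; theorems only)

Topic `Literature/NumberTheory/LFunctions/Zhang2022` (Landau–Siegel audit tree; verdict-neutral).
Y. Zhang, arXiv:2211.02515v1 (2022) [Zhang2022LandauSiegel] is an unrefereed manuscript under
adjudication; NOTHING here asserts or denies its Theorems 1–2 and nothing here is a claim about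
Landau–Siegel zeros.  Theorems only (no `def`): real ARITHMETIC on ls-Bell-typer-1's SET-form first-order value
`EllRegime.firstOrderValue gain G₀ G₁ G₂ (λ, c′) = gain + G₀ + λ·G₁ + c′·G₂` (`EllRegimeStatements.lean` Part 6)
and the box lemmas of `EllFirstOrderBox.lean`, at the DATA the cell's numerics print for the three `K₀` profiles
`u ∈ {k₁ − k₃, k₁ + k₂, k₂ + k₃}` (B-ell/designs/ell-K0-pos.json 2468438745836aa0).  GO of record: ls-Bell-plan
2026-08-26T20:07:59Z (b) / ls-Bell-typer-1 g2 20:33:10Z «typer-2 takes the K₀ kernel instantiation, own module».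

## STATUS 2026-08-26T22:50Z — a SUPERSEDED HYBRID BOOKING (docstring note; no declaration changed)

The numerical ROWS of this file (`gain = (1+τ₀)(16,4,4)π` frozen-phase cushion + global-phase `G₀ = −τ₀(64,36,4)π` +
detuning `(192,176,48)π²` with the `c′_det` floor; margins `(112+48τ₀, 92+56τ₀, 28+24τ₀)π` and the W/no-phase
siblings) are the cell's PRE-DERIVATION booking of 20:46Z–21:00Z.  The derivation of record, ls-Bell-deriv-1
`D-ELL-1-K0.md` v0.1 (sha16 `c639fc46be0504c8`, 21:54Z; REF-B2 READ 22:08:35Z «SURVIVES»; ls-ref-1 test #1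
discharge 22:41:47Z), books the `K₀` rows in ONE frame (one piece, `L_M` units, Zhang's shifts (2.13) verbatim):
NO gain term on `K₀`, per-residue phase `Φ = (16,4,4)`, dipole `G₁ = −(128,32,32)π`, detuning `D = (192,176,48)`,
one-sided `λ`-box; REF-B2 22:08:35Z (s1): «typed rows (112+48τ₀ …) mix frozen-phase cushion + c′_det floor + global
phase — re-sync to the derivation's two designs; until then cite `firstOrderEmptyOn_K0` as a superseded booking».
THE ROWS OF RECORD are therefore in `EllRegimeK0Table1.lean` (p470344: three vectors, `modelConsistentOn_table1_*`,
`firstOrderEmptyOn_table1`, parametric `modelConsistentOn_k0row`) and `EllRegimeK0Plane.lean` (p472567: the PLANE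
form, `modelConsistentOn_k0Plane`).  What stays in use from THIS file: the parametric closed forms `k0Value_eq`,
`k0Value_modelDetuning`, `k0Value_neg_iff_lt_zeroLine`, `modelConsistentOn_k0_segment_iff`, `modelConsistentOn_k0_of_abs`,
`modelConsistentOn_k0_box_of_abs` (any `(g, p, d)`), which the rows of record instantiate with `g = 0`; the numerical
rows `modelConsistentOn_k13/k12/k23(W)`, `firstOrderEmptyOn_K0(W)(_sheet0)`, `k0Margin_*` remain TRUE kernel
statements about the displayed affine functionals but are NOT the dictionary of record — do not cite them in the word.

## The data (cell numerics of record; every `ℓ ≠ 1` number is CONDITIONAL on registry row E-022 = dict-1)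

Per unit `1/A`, on the `t₀`-sheet `τ₀` (`t₀ = D^{τ₀/2}·𝓛⁵¹⁹`; `τ₀ = 0` = printed `t₀`, `τ₀ = 2B` = RULING-2's
`t₀ = T²`), lineage A kit j259598 «K0-FO-A» (ls-Blen-num-1 g2; HOME/B-ell/num-1y/K0FO-A.md sha16 33612b161bad9fe3,
Arb-256 exact antiderivatives; atoms kit j259291 «K0-ATOMS-A», ls-Bell-num-1 g2; REF-B2 pre-registration
19:18:00Z/20:07:03Z reproduced exactly; lineage-B twin K0-FO-B = ls-Bdh-num-2 g2, pending at this writing):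

* frame-of-record F-part `A·φ(u) → (1 + τ₀)·(16, 4, 4)·π` (the `gain` slot; `φ = r⁻¹F_{ℓr}(u) ≥ 0` by
  ls-obj-eng-3's `mainTermFormEll_rescale` / `mainTerm_frame_nonneg`, p465723/p466709; exact cubics
  `mainTermFormEll_k13/k12/k23_one_sub`, p466878);
* `ℓ′`-phase term `G_phase(u) = −3πτ₀·Im M_R(u,u)`, `Im M_R = (64/3, 12, 4/3)` ⇒ `−τ₀·(64, 36, 4)·π` (the `G₀`
  slot here; FLAGGED reading (β) «global rotation for one-piece formula I», for ls-Bell-deriv-1/theory);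
* detuning coefficient `G₂(u) = π·D_bF(u)`, `D_bF = (192, 176, 48)·π` in the convention OF RECORD («full»:
  detector weights differentiated, lineage A j257567 = lineage B j257317), `= (96, 88, 24)·π` in the «W-frozen»
  convention (flag (α), factor 2); model detuning `c′_det(τ₀) = (1 + τ₀)/(2π)` (ls-theory 17:10:30Z (2)(b));
* dipole coefficient `G₁(u)`: NOT YET DERIVED (D-ELL-1-K0 v0, ls-Bell-deriv-1; `|λ| ≤ Λ`, `Λ ≤ ½` asymptotically
  per deriv-1 19:48:09Z) — it stays a VISIBLE PARAMETER of every theorem below, entering only through the ONE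
  hypothesis `Λ·|G₁(u)| ≤ margin(u, τ₀)·π`.

## What is proved

* `k0Value_eq` — the value at `(λ, c′)` in closed form; `k0Value_modelDetuning` — at the model detuning
  `c′ = c′_det(τ₀)` the `λ`-free part is `((1+τ₀)(g + d/2) − τ₀p)·π`, i.e. the MARGINS
  `(112 + 48τ₀)π`, `(92 + 56τ₀)π`, `(28 + 24τ₀)π` (full) — `k0Margin_k13/k12/k23` — and `64π`, `(48 + 12τ₀)π`,
  `(16 + 12τ₀)π` (W-frozen) — `k0MarginW_*`; all `> 0` for `τ₀ ≥ 0` (`k0Margin_*_pos`).  Numerics check: at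
  `τ₀ = 0` the margins are `112π, 92π, 28π` = K0FO-A «S full» `351.858…, 289.026…, 87.964…`; at `τ₀ = 2.04`:
  `209.92π, 206.24π, 76.96π` ✓.
* `modelConsistentOn_k0_segment` — on `𝓜 = Icc l₁ l₂ ×ˢ {c′_det(τ₀)}` model-consistency of the row
  `(gain, G₀, G₁, G₂) = ((1+τ₀)gπ, −τ₀pπ, G₁, dπ²)` ⇔ `margin·π + l₁G₁ ≥ 0 ∧ margin·π + l₂G₁ ≥ 0`; hence
  `modelConsistentOn_k0_of_abs` — `Λ·|G₁| ≤ margin·π ⇒` consistent on `Icc (−Λ) Λ ×ˢ {c′_det}`;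
* `modelConsistentOn_k0_box_of_abs` — the same on the box `Icc (−Λ) Λ ×ˢ Icc (c′_det) c₂` (larger detuning
  only helps: `d > 0`), and `k0Value_neg_iff_lt_zeroLine` — at `λ = 0` the value is `< 0` iff
  `c′ < c′*(τ₀) = (τ₀p − (1+τ₀)g)/(dπ)` (the K0FO-A §3 zero line: negative sub-box on the `τ₀ = 2.04` sheet
  below `c′* ≈ 0.136 / 0.111`, none at `τ₀ = 0` since `c′* < 0`);
* the three instances `modelConsistentOn_k13/_k12/_k23` (full convention) and `firstOrderEmptyOn_K0` —
  `FirstOrderEmptyOn univ data M` for the `K₀` triple over any admissible box `M ∋ (λ₀, c′_det(τ₀))` with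
  `|λ₀| ≤ Λ`, GIVEN the three size hypotheses `Λ·|G₁(u)| ≤ margin(u,τ₀)·π` — the kernel form of «test #1
  passes on K₀» modulo deriv-1's `G₁` (one `norm_num` line per vector once `G₁(u)` and `Λ` are printed).

(v2) Convention siblings so that whichever reading deriv-1/theory fix is already instantiated: W-frozen rows
`modelConsistentOn_k13W/k12W/k23W` + `firstOrderEmptyOn_K0W` (`d` halved, margins `64π / (48+12τ₀)π / (16+12τ₀)π`),
and the no-phase variant `modelConsistentOn_k0_noPhase` (`p = 0`, margins `(1+τ₀)(g + d/2)π`).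

Deliberately NOT here: any value of `G₁`, the set `𝓜` of theory's ruling (δ) beyond segments/boxes at the model
detuning, the tie/G5/G6 rows (D-ELL-1c), and any claim that dict-1 (E-022) holds.

## References
* Y. Zhang, arXiv:2211.02515v1 (2022), §2 (2.10), (2.13), (2.23)–(2.25), (2.32); §7 Prop. 7.1; §8 Lemmas 8.2–8.4
  (the shifted detector, the profiles and the main-term dictionary whose first-order reading this is).
  [Zhang2022LandauSiegel]

«The programme SEARCHES and TYPES; no claim about Landau–Siegel zeros, Theorems 1–2 of arXiv:2211.02515 or
a repaired Margin232 until a kernel theorem says so.»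
-/

noncomputable section

open Real Set

namespace Literature.NumberTheory.LFunctions.Zhang2022.EllRegime

/-! ## The `K₀`-shape first-order value in closed form -/

/-- The value of a `K₀`-shape row `(gain, G₀, G₁, G₂) = ((1+τ₀)·g·π, −τ₀·p·π, G₁, d·π²)` at `(λ, c′)`.
[cite: Zhang2022LandauSiegel, §2 (2.13), (2.32)] -/
theorem k0Value_eq (g p d τ₀ G₁ lam c : ℝ) :
    firstOrderValue ((1 + τ₀) * g * π) (-(τ₀ * p * π)) G₁ (d * π ^ 2) (lam, c) =
      ((1 + τ₀) * g - τ₀ * p) * π + lam * G₁ + c * d * π ^ 2 := by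
  simp only [firstOrderValue]; ring

/-- **At the model detuning `c′_det(τ₀) = (1+τ₀)/(2π)`** the `λ`-free part is `((1+τ₀)(g + d/2) − τ₀p)·π`.
[cite: Zhang2022LandauSiegel, §2 (2.13), (2.32)] -/
theorem k0Value_modelDetuning (g p d τ₀ G₁ lam : ℝ) :
    firstOrderValue ((1 + τ₀) * g * π) (-(τ₀ * p * π)) G₁ (d * π ^ 2) (lam, (1 + τ₀) / (2 * π)) =
      ((1 + τ₀) * (g + d / 2) - τ₀ * p) * π + lam * G₁ := by
  simp only [firstOrderValue]
  field_simp
  ring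

/-- **The zero line at `λ = 0`**: for `d > 0` the value at `(0, c′)` is `< 0` iff `c′ < c′*(τ₀) := (τ₀p − (1+τ₀)g)/(d·π)`
(K0FO-A §3; at `τ₀ = 0` with `g > 0`, `c′* < 0`: no sign flip for `c′ ≥ 0`). [cite: Zhang2022LandauSiegel, §2 (2.13), (2.32)] -/
theorem k0Value_neg_iff_lt_zeroLine {g p d τ₀ G₁ c : ℝ} (hd : 0 < d) :
    firstOrderValue ((1 + τ₀) * g * π) (-(τ₀ * p * π)) G₁ (d * π ^ 2) (0, c) < 0 ↔
      c < (τ₀ * p - (1 + τ₀) * g) / (d * π) := by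
  rw [k0Value_eq, zero_mul, add_zero, lt_div_iff₀ (by positivity)]
  constructor <;> intro h <;> nlinarith [Real.pi_pos, mul_pos hd Real.pi_pos]

/-! ## Model-consistency of a `K₀`-shape row on a segment / box at the model detuning -/

/-- **Segment form**: on `𝓜 = [l₁, l₂] × {c′_det(τ₀)}` the row is model-consistent iff
`margin·π + l₁·G₁ ≥ 0` and `margin·π + l₂·G₁ ≥ 0`, `margin = (1+τ₀)(g + d/2) − τ₀p`.
[cite: Zhang2022LandauSiegel, §2 (2.13), (2.32)] -/
theorem modelConsistentOn_k0_segment_iff {g p d τ₀ G₁ l₁ l₂ : ℝ} (hl : l₁ ≤ l₂) :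
    ModelConsistentOn (Icc l₁ l₂ ×ˢ {(1 + τ₀) / (2 * π)}) ((1 + τ₀) * g * π) (-(τ₀ * p * π)) G₁ (d * π ^ 2) ↔
      0 ≤ ((1 + τ₀) * (g + d / 2) - τ₀ * p) * π + l₁ * G₁ ∧
      0 ≤ ((1 + τ₀) * (g + d / 2) - τ₀ * p) * π + l₂ * G₁ := by
  rw [modelConsistentOn_segment_iff hl, k0Value_modelDetuning, k0Value_modelDetuning]

/-- **Size form**: if `Λ·|G₁| ≤ margin·π` then the row is model-consistent on `[−Λ, Λ] × {c′_det(τ₀)}`.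
[cite: Zhang2022LandauSiegel, §2 (2.13), (2.32)] -/
theorem modelConsistentOn_k0_of_abs {g p d τ₀ G₁ Λ : ℝ} (hΛ : 0 ≤ Λ)
    (h : Λ * |G₁| ≤ ((1 + τ₀) * (g + d / 2) - τ₀ * p) * π) :
    ModelConsistentOn (Icc (-Λ) Λ ×ˢ {(1 + τ₀) / (2 * π)}) ((1 + τ₀) * g * π) (-(τ₀ * p * π)) G₁ (d * π ^ 2) := by
  rw [modelConsistentOn_k0_segment_iff (by linarith)]
  have h1 : -(Λ * |G₁|) ≤ -Λ * G₁ := by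
    rw [neg_mul, neg_le_neg_iff]; exact mul_le_mul_of_nonneg_left (le_abs_self _) hΛ
  have h2 : -(Λ * |G₁|) ≤ Λ * G₁ := by
    rw [neg_le]; calc -(Λ * G₁) = Λ * (-G₁) := by ring
      _ ≤ Λ * |G₁| := mul_le_mul_of_nonneg_left (neg_le_abs _) hΛ
  constructor <;> linarith

/-- **Box form**: with `d ≥ 0` a larger detuning only helps, so `Λ·|G₁| ≤ margin·π` gives model-consistency on
the box `[−Λ, Λ] × [c′_det(τ₀), c₂]` for every `c₂ ≥ c′_det`. [cite: Zhang2022LandauSiegel, §2 (2.13), (2.32)] -/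
theorem modelConsistentOn_k0_box_of_abs {g p d τ₀ G₁ Λ c₂ : ℝ} (hΛ : 0 ≤ Λ) (hd : 0 ≤ d)
    (hc₂ : (1 + τ₀) / (2 * π) ≤ c₂) (h : Λ * |G₁| ≤ ((1 + τ₀) * (g + d / 2) - τ₀ * p) * π) :
    ModelConsistentOn (Icc (-Λ) Λ ×ˢ Icc ((1 + τ₀) / (2 * π)) c₂)
      ((1 + τ₀) * g * π) (-(τ₀ * p * π)) G₁ (d * π ^ 2) := by
  have hseg := modelConsistentOn_k0_of_abs (g := g) (p := p) (d := d) (τ₀ := τ₀) hΛ h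
  rw [modelConsistentOn_k0_segment_iff (by linarith)] at hseg
  obtain ⟨h₁, h₂⟩ := hseg
  have hmono : ∀ lam : ℝ, 0 ≤ ((1 + τ₀) * (g + d / 2) - τ₀ * p) * π + lam * G₁ →
      0 ≤ firstOrderValue ((1 + τ₀) * g * π) (-(τ₀ * p * π)) G₁ (d * π ^ 2) (lam, c₂) := by
    intro lam hlam
    have e := k0Value_modelDetuning g p d τ₀ G₁ lam
    have hdiff : firstOrderValue ((1 + τ₀) * g * π) (-(τ₀ * p * π)) G₁ (d * π ^ 2) (lam, c₂) -
        firstOrderValue ((1 + τ₀) * g * π) (-(τ₀ * p * π)) G₁ (d * π ^ 2) (lam, (1 + τ₀) / (2 * π)) =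
        (c₂ - (1 + τ₀) / (2 * π)) * (d * π ^ 2) := by
      simp only [firstOrderValue]; ring
    have hnn : 0 ≤ (c₂ - (1 + τ₀) / (2 * π)) * (d * π ^ 2) := mul_nonneg (by linarith) (by positivity)
    linarith
  refine modelConsistentOn_box_of_corners ?_ (hmono _ h₁) ?_ (hmono _ h₂)
  · rw [k0Value_modelDetuning]; exact h₁
  · rw [k0Value_modelDetuning]; exact h₂

/-! ## The three `K₀` rows (convention of record «full»: `d = (192, 176, 48)`; `g = (16, 4, 4)`, `p = (64, 36, 4)`) -/

/-- `k₁ − k₃`: margin at the model detuning `= (112 + 48τ₀)·π` (K0FO-A: `112π = 351.858…` at `τ₀ = 0`,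
`209.92π` at `τ₀ = 2.04`). [cite: Zhang2022LandauSiegel, §2 (2.13), (2.23)–(2.25), (2.32)] -/
theorem k0Margin_k13 (τ₀ : ℝ) : ((1 + τ₀) * (16 + 192 / 2) - τ₀ * 64 : ℝ) = 112 + 48 * τ₀ := by ring

/-- `k₁ + k₂`: margin `= (92 + 56τ₀)·π` (`92π = 289.026…`; `206.24π` at `τ₀ = 2.04`).
[cite: Zhang2022LandauSiegel, §2 (2.13), (2.23)–(2.25), (2.32)] -/
theorem k0Margin_k12 (τ₀ : ℝ) : ((1 + τ₀) * (4 + 176 / 2) - τ₀ * 36 : ℝ) = 92 + 56 * τ₀ := by ring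

/-- `k₂ + k₃`: margin `= (28 + 24τ₀)·π` (`28π = 87.964…`; `76.96π` at `τ₀ = 2.04`).
[cite: Zhang2022LandauSiegel, §2 (2.13), (2.23)–(2.25), (2.32)] -/
theorem k0Margin_k23 (τ₀ : ℝ) : ((1 + τ₀) * (4 + 48 / 2) - τ₀ * 4 : ℝ) = 28 + 24 * τ₀ := by ring

/-- W-frozen convention (flag (α): `d` halved): margins `64·π` (τ₀-free), `(48 + 12τ₀)·π`, `(16 + 12τ₀)·π`
(K0FO-A «S Wfrozen» `64π, 72.48π, 40.48π` at `τ₀ = 2.04`). [cite: Zhang2022LandauSiegel, §2 (2.13), (2.32)] -/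
theorem k0MarginW (τ₀ : ℝ) :
    ((1 + τ₀) * (16 + 96 / 2) - τ₀ * 64 : ℝ) = 64 ∧ ((1 + τ₀) * (4 + 88 / 2) - τ₀ * 36 : ℝ) = 48 + 12 * τ₀ ∧
      ((1 + τ₀) * (4 + 24 / 2) - τ₀ * 4 : ℝ) = 16 + 12 * τ₀ := by
  refine ⟨by ring, by ring, by ring⟩

/-- **The parameter-free part of test #1 PASSES on all three `K₀` rows, on every sheet `τ₀ ≥ 0`, in both
conventions** (margins `> 0`). [cite: Zhang2022LandauSiegel, §2 (2.13), (2.32)] -/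
theorem k0Margin_pos {τ₀ : ℝ} (hτ : 0 ≤ τ₀) :
    0 < (112 + 48 * τ₀) * π ∧ 0 < (92 + 56 * τ₀) * π ∧ 0 < (28 + 24 * τ₀) * π ∧
      0 < (64 : ℝ) * π ∧ 0 < (48 + 12 * τ₀) * π ∧ 0 < (16 + 12 * τ₀) * π := by
  have hπ := Real.pi_pos
  refine ⟨?_, ?_, ?_, ?_, ?_, ?_⟩ <;> positivity

/-- **`k₁ − k₃` row, model-consistent on `[−Λ, Λ] × [c′_det(τ₀), c₂]` GIVEN `Λ·|G₁| ≤ (112 + 48τ₀)π`.**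
[cite: Zhang2022LandauSiegel, §2 (2.13), (2.23)–(2.25), (2.32)] -/
theorem modelConsistentOn_k13 {τ₀ G₁ Λ c₂ : ℝ} (hΛ : 0 ≤ Λ) (hc₂ : (1 + τ₀) / (2 * π) ≤ c₂)
    (h : Λ * |G₁| ≤ (112 + 48 * τ₀) * π) :
    ModelConsistentOn (Icc (-Λ) Λ ×ˢ Icc ((1 + τ₀) / (2 * π)) c₂)
      ((1 + τ₀) * 16 * π) (-(τ₀ * 64 * π)) G₁ (192 * π ^ 2) :=
  modelConsistentOn_k0_box_of_abs hΛ (by norm_num) hc₂ (by rw [k0Margin_k13]; exact h)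

/-- **`k₁ + k₂` row, model-consistent GIVEN `Λ·|G₁| ≤ (92 + 56τ₀)π`.** [cite: Zhang2022LandauSiegel, §2 (2.13), (2.23)–(2.25), (2.32)] -/
theorem modelConsistentOn_k12 {τ₀ G₁ Λ c₂ : ℝ} (hΛ : 0 ≤ Λ) (hc₂ : (1 + τ₀) / (2 * π) ≤ c₂)
    (h : Λ * |G₁| ≤ (92 + 56 * τ₀) * π) :
    ModelConsistentOn (Icc (-Λ) Λ ×ˢ Icc ((1 + τ₀) / (2 * π)) c₂)
      ((1 + τ₀) * 4 * π) (-(τ₀ * 36 * π)) G₁ (176 * π ^ 2) :=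
  modelConsistentOn_k0_box_of_abs hΛ (by norm_num) hc₂ (by rw [k0Margin_k12]; exact h)

/-- **`k₂ + k₃` row, model-consistent GIVEN `Λ·|G₁| ≤ (28 + 24τ₀)π`.** [cite: Zhang2022LandauSiegel, §2 (2.13), (2.23)–(2.25), (2.32)] -/
theorem modelConsistentOn_k23 {τ₀ G₁ Λ c₂ : ℝ} (hΛ : 0 ≤ Λ) (hc₂ : (1 + τ₀) / (2 * π) ≤ c₂)
    (h : Λ * |G₁| ≤ (28 + 24 * τ₀) * π) :
    ModelConsistentOn (Icc (-Λ) Λ ×ˢ Icc ((1 + τ₀) / (2 * π)) c₂)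
      ((1 + τ₀) * 4 * π) (-(τ₀ * 4 * π)) G₁ (48 * π ^ 2) :=
  modelConsistentOn_k0_box_of_abs hΛ (by norm_num) hc₂ (by rw [k0Margin_k23]; exact h)

/-! ## First-order emptiness of the `K₀` triple over any admissible box meeting the model box -/

/-- **`FirstOrderEmptyOn` for the `K₀` triple** (index `0 ↦ k₁ − k₃`, `1 ↦ k₁ + k₂`, `2 ↦ k₂ + k₃`; data
`((1+τ₀)gπ, −τ₀pπ, G₁(u), dπ²)` in the convention of record), over ANY datum set `M` containing a point
`(λ₀, c₀)` of the model box `[−Λ, Λ] × [c′_det(τ₀), c₂]`, GIVEN the three dipole-size hypotheses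
`Λ·|G₁(u)| ≤ margin(u, τ₀)·π` — the kernel form of «test #1 passes on `K₀` ⇒ no `K₀` design closes at first
order over `M`» (ls-ref-1 17:32:27Z gate; KILL-draft §1 `K₀` clause).  The `G₁(u)` are deriv-1's (D-ELL-1-K0),
parameters here. [cite: Zhang2022LandauSiegel, §2 (2.13), (2.23)–(2.25), (2.32)] -/
theorem firstOrderEmptyOn_K0 {τ₀ Λ c₂ G₁a G₁b G₁c lam₀ c₀ : ℝ} {M : Set (ℝ × ℝ)} (hΛ : 0 ≤ Λ)
    (hc₂ : (1 + τ₀) / (2 * π) ≤ c₂)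
    (ha : Λ * |G₁a| ≤ (112 + 48 * τ₀) * π) (hb : Λ * |G₁b| ≤ (92 + 56 * τ₀) * π)
    (hc : Λ * |G₁c| ≤ (28 + 24 * τ₀) * π)
    (hlam₀ : |lam₀| ≤ Λ) (hc₀ : (1 + τ₀) / (2 * π) ≤ c₀) (hc₀' : c₀ ≤ c₂) (hM : (lam₀, c₀) ∈ M) :
    FirstOrderEmptyOn (Set.univ : Set (Fin 3))
      ![((1 + τ₀) * 16 * π, -(τ₀ * 64 * π), G₁a, 192 * π ^ 2),
        ((1 + τ₀) * 4 * π, -(τ₀ * 36 * π), G₁b, 176 * π ^ 2),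
        ((1 + τ₀) * 4 * π, -(τ₀ * 4 * π), G₁c, 48 * π ^ 2)] M := by
  have hmem : (lam₀, c₀) ∈ Icc (-Λ) Λ ×ˢ Icc ((1 + τ₀) / (2 * π)) c₂ :=
    ⟨⟨(abs_le.mp hlam₀).1, (abs_le.mp hlam₀).2⟩, ⟨hc₀, hc₀'⟩⟩
  intro i _
  fin_cases i
  · exact not_closesFirstOrderOn_of_mem (modelConsistentOn_k13 hΛ hc₂ ha) hmem hM
  · exact not_closesFirstOrderOn_of_mem (modelConsistentOn_k12 hΛ hc₂ hb) hmem hM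
  · exact not_closesFirstOrderOn_of_mem (modelConsistentOn_k23 hΛ hc₂ hc) hmem hM

/-- **Printed-`t₀` sheet (`τ₀ = 0`) with the deriv-1 bound `Λ = ½`**: the three size hypotheses read
`|G₁(k₁−k₃)| ≤ 224π`, `|G₁(k₁+k₂)| ≤ 184π`, `|G₁(k₂+k₃)| ≤ 56π`. [cite: Zhang2022LandauSiegel, §2 (2.13), (2.32)] -/
theorem firstOrderEmptyOn_K0_sheet0 {c₂ G₁a G₁b G₁c lam₀ c₀ : ℝ} {M : Set (ℝ × ℝ)}
    (hc₂ : 1 / (2 * π) ≤ c₂) (ha : |G₁a| ≤ 224 * π) (hb : |G₁b| ≤ 184 * π) (hc : |G₁c| ≤ 56 * π)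
    (hlam₀ : |lam₀| ≤ 1 / 2) (hc₀ : 1 / (2 * π) ≤ c₀) (hc₀' : c₀ ≤ c₂) (hM : (lam₀, c₀) ∈ M) :
    FirstOrderEmptyOn (Set.univ : Set (Fin 3))
      ![((1 + 0) * 16 * π, -(0 * 64 * π), G₁a, 192 * π ^ 2),
        ((1 + 0) * 4 * π, -(0 * 36 * π), G₁b, 176 * π ^ 2),
        ((1 + 0) * 4 * π, -(0 * 4 * π), G₁c, 48 * π ^ 2)] M := by
  have hπ := Real.pi_pos
  refine firstOrderEmptyOn_K0 (τ₀ := 0) (Λ := 1 / 2) (by norm_num) (by simpa using hc₂) ?_ ?_ ?_ hlam₀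
    (by simpa using hc₀) hc₀' hM <;> nlinarith [abs_nonneg G₁a, abs_nonneg G₁b, abs_nonneg G₁c]


/-! ## (v2) The W-frozen convention rows (flag (α): `d = (96, 88, 24)`; margins `64π`, `(48+12τ₀)π`, `(16+12τ₀)π`) -/

/-- `k₁ − k₃`, W-frozen detuning convention: model-consistent on `[−Λ, Λ] × [c′_det(τ₀), c₂]` GIVEN `Λ·|G₁| ≤ 64π`.
[cite: Zhang2022LandauSiegel, §2 (2.13), (2.23)–(2.25), (2.32)] -/
theorem modelConsistentOn_k13W {τ₀ G₁ Λ c₂ : ℝ} (hΛ : 0 ≤ Λ) (hc₂ : (1 + τ₀) / (2 * π) ≤ c₂)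
    (h : Λ * |G₁| ≤ 64 * π) :
    ModelConsistentOn (Icc (-Λ) Λ ×ˢ Icc ((1 + τ₀) / (2 * π)) c₂)
      ((1 + τ₀) * 16 * π) (-(τ₀ * 64 * π)) G₁ (96 * π ^ 2) :=
  modelConsistentOn_k0_box_of_abs hΛ (by norm_num) hc₂ (by rw [(k0MarginW τ₀).1]; exact h)

/-- `k₁ + k₂`, W-frozen: GIVEN `Λ·|G₁| ≤ (48 + 12τ₀)π`. [cite: Zhang2022LandauSiegel, §2 (2.13), (2.23)–(2.25), (2.32)] -/
theorem modelConsistentOn_k12W {τ₀ G₁ Λ c₂ : ℝ} (hΛ : 0 ≤ Λ) (hc₂ : (1 + τ₀) / (2 * π) ≤ c₂)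
    (h : Λ * |G₁| ≤ (48 + 12 * τ₀) * π) :
    ModelConsistentOn (Icc (-Λ) Λ ×ˢ Icc ((1 + τ₀) / (2 * π)) c₂)
      ((1 + τ₀) * 4 * π) (-(τ₀ * 36 * π)) G₁ (88 * π ^ 2) :=
  modelConsistentOn_k0_box_of_abs hΛ (by norm_num) hc₂ (by rw [(k0MarginW τ₀).2.1]; exact h)

/-- `k₂ + k₃`, W-frozen: GIVEN `Λ·|G₁| ≤ (16 + 12τ₀)π`. [cite: Zhang2022LandauSiegel, §2 (2.13), (2.23)–(2.25), (2.32)] -/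
theorem modelConsistentOn_k23W {τ₀ G₁ Λ c₂ : ℝ} (hΛ : 0 ≤ Λ) (hc₂ : (1 + τ₀) / (2 * π) ≤ c₂)
    (h : Λ * |G₁| ≤ (16 + 12 * τ₀) * π) :
    ModelConsistentOn (Icc (-Λ) Λ ×ˢ Icc ((1 + τ₀) / (2 * π)) c₂)
      ((1 + τ₀) * 4 * π) (-(τ₀ * 4 * π)) G₁ (24 * π ^ 2) :=
  modelConsistentOn_k0_box_of_abs hΛ (by norm_num) hc₂ (by rw [(k0MarginW τ₀).2.2]; exact h)

/-- **`FirstOrderEmptyOn` for the `K₀` triple in the W-frozen convention**, GIVEN `Λ·|G₁(u)| ≤ 64π`,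
`(48+12τ₀)π`, `(16+12τ₀)π`. [cite: Zhang2022LandauSiegel, §2 (2.13), (2.23)–(2.25), (2.32)] -/
theorem firstOrderEmptyOn_K0W {τ₀ Λ c₂ G₁a G₁b G₁c lam₀ c₀ : ℝ} {M : Set (ℝ × ℝ)} (hΛ : 0 ≤ Λ)
    (hc₂ : (1 + τ₀) / (2 * π) ≤ c₂)
    (ha : Λ * |G₁a| ≤ 64 * π) (hb : Λ * |G₁b| ≤ (48 + 12 * τ₀) * π) (hc : Λ * |G₁c| ≤ (16 + 12 * τ₀) * π)
    (hlam₀ : |lam₀| ≤ Λ) (hc₀ : (1 + τ₀) / (2 * π) ≤ c₀) (hc₀' : c₀ ≤ c₂) (hM : (lam₀, c₀) ∈ M) :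
    FirstOrderEmptyOn (Set.univ : Set (Fin 3))
      ![((1 + τ₀) * 16 * π, -(τ₀ * 64 * π), G₁a, 96 * π ^ 2),
        ((1 + τ₀) * 4 * π, -(τ₀ * 36 * π), G₁b, 88 * π ^ 2),
        ((1 + τ₀) * 4 * π, -(τ₀ * 4 * π), G₁c, 24 * π ^ 2)] M := by
  have hmem : (lam₀, c₀) ∈ Icc (-Λ) Λ ×ˢ Icc ((1 + τ₀) / (2 * π)) c₂ :=
    ⟨⟨(abs_le.mp hlam₀).1, (abs_le.mp hlam₀).2⟩, ⟨hc₀, hc₀'⟩⟩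
  intro i _
  fin_cases i
  · exact not_closesFirstOrderOn_of_mem (modelConsistentOn_k13W hΛ hc₂ ha) hmem hM
  · exact not_closesFirstOrderOn_of_mem (modelConsistentOn_k12W hΛ hc₂ hb) hmem hM
  · exact not_closesFirstOrderOn_of_mem (modelConsistentOn_k23W hΛ hc₂ hc) hmem hM

/-! ## (v2) No-phase variant (flag (β): if the `ℓ′`-phase rotation is NOT of record, `p = 0` and the margins are
`(1+τ₀)·(112, 92, 28)·π` full / `(1+τ₀)·(64, 48, 16)·π` W-frozen) -/

/-- With `p = 0` the margin at the model detuning is `(1+τ₀)(g + d/2)·π`; in particular for the three `K₀` rows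
(full) `(1+τ₀)·112π`, `(1+τ₀)·92π`, `(1+τ₀)·28π`. [cite: Zhang2022LandauSiegel, §2 (2.13), (2.32)] -/
theorem k0Margin_noPhase (g d τ₀ : ℝ) : ((1 + τ₀) * (g + d / 2) - τ₀ * 0 : ℝ) = (1 + τ₀) * (g + d / 2) := by ring

/-- No-phase `K₀` rows (full convention): model-consistent on the box GIVEN `Λ·|G₁(u)| ≤ (1+τ₀)·margin₀(u)·π`,
`margin₀ = (112, 92, 28)`. [cite: Zhang2022LandauSiegel, §2 (2.13), (2.23)–(2.25), (2.32)] -/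
theorem modelConsistentOn_k0_noPhase {g d τ₀ G₁ Λ c₂ : ℝ} (hΛ : 0 ≤ Λ) (hd : 0 ≤ d)
    (hc₂ : (1 + τ₀) / (2 * π) ≤ c₂) (h : Λ * |G₁| ≤ (1 + τ₀) * (g + d / 2) * π) :
    ModelConsistentOn (Icc (-Λ) Λ ×ˢ Icc ((1 + τ₀) / (2 * π)) c₂)
      ((1 + τ₀) * g * π) (-(τ₀ * 0 * π)) G₁ (d * π ^ 2) :=
  modelConsistentOn_k0_box_of_abs hΛ hd hc₂ (by rw [k0Margin_noPhase]; exact h)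

end Literature.NumberTheory.LFunctions.Zhang2022.EllRegime

end
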